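import Literature.NumberTheory.EllipticCurves.LocalEulerCharacteristicTorsion
import Summits.BirchSwinnertonDyer.Rank1Residual.GaloisImage.PropagatedConditionCardEP
import Summits.BirchSwinnertonDyer.BirchSwinnertonDyer.Theorems.ThetaPartnerAtTwoSignedControlAtTwoRelaxedKummerCount
import HarnessLib

/-!
# `#H¹(K_v, M) ≥ #M` at a place `v ∣ p` for a finite `p`-primary `M` — the LOCAL input of the weak-Leopoldt inequality
# (crux ♭T′ stmt-BirchSwinnertonDyer-26975, line `sigmacongruence`, input (1a″) of the growth road to stub TS1)

Route `UniversalToricDescent`, lead prover `bsd-wall-utd-p1` g15. THEOREMS ONLY (no definition, no named fact, no `sorry`);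
`--supports stmt-BirchSwinnertonDyer-26975`. BSD is not proved by any of this.

Tate's local Euler–Poincaré characteristic is a THEOREM of the tree at every completion of a number field
(`Summit.BirchSwinnertonDyer.Rank1Residual.GaloisImage.EP.localEulerPoincareCharacteristic_adicCompletion`, read with
`𝓞_v = v.adicCompletionIntegers K` by `Literature.NumberTheory.EllipticCurves.localEulerPoincareCharacteristic_adicCompletion`):
`#M^{Γ_{K_v}} · #H²(K_v, M) · #(𝓞_v/#M) = #H¹(K_v, M)`. Hence (`natCard_quot_le_natCard_localH1`) `#(𝓞_v/#M) ≤ #H¹(K_v, M)`, and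
for `#M = p^a`, `v ∣ p`: **`p^a ≤ #H¹(K_v, M)`** (`prime_pow_le_natCard_localH1`, via the tree's
`prime_pow_le_natCard_quot_adicCompletionIntegers`); over a finite set `P` of places above `p`:
`p^{a·#P} ≤ ∏_{v∈P} #H¹(K_v, M_v)` (`prime_pow_mul_card_le_prod_natCard_localH1`). With the weak-Leopoldt inequality
`prod_natCard_localH1_le_of_poitouTate` (p645604) and `#P = 2` (imaginary quadratic `K`, `p` split) this is the growth
`#H¹_{S-rel}(K, N)² ≥ #N²` for the self-dual induced modules `N = Ind_{K_n}^K E′[3^k]`, `#N = 3^{2k·3^n}`.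

References: [MilneADT2006] I Thm. 2.8; [GreenbergVatsal2000] §2 Prop. (2.1).
-/

set_option autoImplicit false
-- the Theorems namespace of this sub repeats the summit name by design (D-0017 nested layout)
set_option linter.dupNamespace false

noncomputable section

open scoped Classical NumberField
open NumberField IsDedekindDomain
open Literature.NumberTheory.GaloisRepresentations Literature.NumberTheory.EllipticCurves

namespace Summit.BirchSwinnertonDyer.BirchSwinnertonDyer.Theorems.UniversalToricDescentLocalH1LowerBound

variable {K : Type} [Field K] [NumberField K] (v : HeightOneSpectrum (𝓞 K))
  {M : Type} [AddCommGroup M] [TopologicalSpace M] [DiscreteTopology M] [Finite M]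

/-- **`#(𝓞_v ⧸ (#M)𝓞_v) ≤ #H¹(K_v, M)`** for every finite discrete `Γ_{K_v}`-module `M` (Euler characteristic, the factors
`#M^{Γ}` and `#H²` being `≥ 1`). [cite: MilneADT2006, Ch. I §2, Thm. 2.8 (p. 31)] -/
theorem natCard_quot_le_natCard_localH1 (ρ : DiscreteGaloisModule (v.adicCompletion K) M) :
    Nat.card (v.adicCompletionIntegers K ⧸ Ideal.span {((Nat.card M : ℕ) : v.adicCompletionIntegers K)}) ≤
      Nat.card (galoisCohomology ρ 1) := by
  obtain ⟨_, h2, heq⟩ := localEulerPoincareCharacteristic_adicCompletion K v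
    (Summit.BirchSwinnertonDyer.Rank1Residual.GaloisImage.EP.localEulerPoincareCharacteristic_adicCompletion K v) ρ
  rw [← heq]
  haveI : Finite ρ.toTopRep.ρ.invariants := Finite.of_injective _ Subtype.val_injective
  have h0 : 0 < Nat.card ρ.toTopRep.ρ.invariants := Nat.card_pos
  have h2' : 0 < Nat.card (galoisCohomology ρ 2) := Nat.card_pos
  calc _ = 1 * 1 * Nat.card (v.adicCompletionIntegers K ⧸
        Ideal.span {((Nat.card M : ℕ) : v.adicCompletionIntegers K)}) := by rw [one_mul, one_mul]
    _ ≤ _ := Nat.mul_le_mul_right _ (Nat.mul_le_mul h0 h2')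

/-- **`p^a ≤ #H¹(K_v, M)` at `v ∣ p` for `#M = p^a`** (`#(𝓞_v/p^a) ≥ p^a`: the tree's
`prime_pow_le_natCard_quot_adicCompletionIntegers`). [cite: MilneADT2006, Ch. I §2, Thm. 2.8 (p. 31)] -/
theorem prime_pow_le_natCard_localH1 (p : ℕ) [Fact p.Prime] (hv : ((p : ℕ) : 𝓞 K) ∈ v.asIdeal)
    (ρ : DiscreteGaloisModule (v.adicCompletion K) M) {a : ℕ} (hM : Nat.card M = p ^ a) :
    p ^ a ≤ Nat.card (galoisCohomology ρ 1) := by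
  refine le_trans ?_ (natCard_quot_le_natCard_localH1 v ρ)
  rw [hM]
  exact SignedEC.RelaxedKummerCount.prime_pow_le_natCard_quot_adicCompletionIntegers p hv a

/-- **`p^{a·#P} ≤ ∏_{v∈P} #H¹(K_v, M_v)`** for a finite set `P` of places above `p` and finite discrete `Γ_{K_v}`-modules `M_v`
of order `p^a` (for the weak-Leopoldt growth: `P` = the places above `p`, `M_v` = the local restriction of one global
module). [cite: MilneADT2006, Ch. I §2, Thm. 2.8 (p. 31)] [cite: GreenbergVatsal2000, §2 Prop. (2.1)] -/
theorem prime_pow_mul_card_le_prod_natCard_localH1 (p : ℕ) [Fact p.Prime] (P : Finset (HeightOneSpectrum (𝓞 K)))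
    (hP : ∀ v ∈ P, ((p : ℕ) : 𝓞 K) ∈ v.asIdeal)
    {Mv : HeightOneSpectrum (𝓞 K) → Type} [∀ v, AddCommGroup (Mv v)] [∀ v, TopologicalSpace (Mv v)]
    [∀ v, DiscreteTopology (Mv v)] [∀ v, Finite (Mv v)]
    (ρ : ∀ v : HeightOneSpectrum (𝓞 K), DiscreteGaloisModule (v.adicCompletion K) (Mv v)) {a : ℕ}
    (hM : ∀ v ∈ P, Nat.card (Mv v) = p ^ a) :
    p ^ (a * P.card) ≤ ∏ v ∈ P, Nat.card (galoisCohomology (ρ v) 1) := by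
  rw [pow_mul, ← Finset.prod_const]
  exact Finset.prod_le_prod' fun v hv ↦ prime_pow_le_natCard_localH1 v p (hP v hv) (ρ v) (hM v hv)

end Summit.BirchSwinnertonDyer.BirchSwinnertonDyer.Theorems.UniversalToricDescentLocalH1LowerBound

end
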